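import Summits.ResolutionOfSingularities.ResolutionOfSingularities.Theorems.EquisingularLiftEquisingularLiftNatTowerBEmbRoundCoreTransversal
import Summits.ResolutionOfSingularities.ResolutionOfSingularities.Theorems.EquisingularLiftEquisingularLiftNatTowerBConeRoundCoreTransversal
import Summits.ResolutionOfSingularities.ResolutionOfSingularities.Theorems.EquisingularLiftEquisingularLiftNatTowerBRoundOfFact
import Summits.ResolutionOfSingularities.ResolutionOfSingularities.Theorems.EquisingularLiftEquisingularLiftNatTowerRoundBPrimeDefs
import Summits.ResolutionOfSingularities.ResolutionOfSingularities.Theorems.EquisingularLiftEquisingularLiftNatTransversalHasSNCWithOfTrace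
import Summits.ResolutionOfSingularities.ResolutionOfSingularities.Theorems.EquisingularLiftEquisingularLiftNatTransversalStrictTransformTraceSlim
import Summits.ResolutionOfSingularities.ResolutionOfSingularities.Theorems.EquisingularLiftEquisingularLiftNatStrictTransformFlat
import HarnessLib

/-!
# [OURS · L1 W4.5(b) · EL♮(3) · T23-A′] THE ROUNDS OF `TowerRoundBPrime` ON `Tower.InvB` AT THE DATUM «`V(𝓔)` IS `O`-FLAT» — the (P2) re-cuts of
# res-L1-w45b-stub-4's `Tower.invB_embRound_of_fact_any` / `Tower.invB_coneRound_of_any` (…NatTowerBRoundOfFact p605390) over the widened cores′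

Crux EL♮(3) = stmt-ResolutionOfSingularities-20148 (parent stmt-…-20038); rung target `stub_elnat_defTowerBPrimePointResolutionThree` (res-L1-w45b-lead-2's
TARGET-DEFTOWERBPRIME-THREE f09847aa6e554416; registration = engine-green swap, desk R15). Written by res-L1-w45b-stub-2 g12 on the desk's RE-BOOK
2026-08-28T07:04:31Z (b) «stub-2 = the FE-level dischargers + round-of-fact re-cuts over stub-4's cores′». OURS; NOT a statement of any manuscript;
AI-written, weaker than expert review. DEF-FREE; no `sorry`; standard axioms. `--supports stmt-ResolutionOfSingularities-20148 --as helper`.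

WHAT. `Tower.invB_embRound_of_fact_anyPrime` / `Tower.invB_coneRound_of_anyPrime` = p605390's `Tower.invB_embRound_of_fact_any` / `Tower.invB_coneRound_of_any`
VERBATIM (statements and proofs, adapted copies) except that the
retained-list clause reads `∀ F' ∈ Es', ∃ F ∈ E :: Es, RoundTransportOKPrime υ₂ Z hZ H F F'` (T23-A′: a member CROSSED TRANSVERSALLY by the centre —
stalkwise (T1) ∧ (T2) on the traces — is retained as `closure υ₂⁻¹(F ∖ Z)`) and the cores are res-L1-w45b-stub-4's `Tower.invB_embRoundCore'` /
`Tower.invB_coneRoundCore'` (…NatTowerB{Emb,Cone}RoundCoreTransversal) with `X3 F := ∃ hF, (T1) ∧ (T2)`; their three NEW obligations are discharged HERE at the engine datum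
`FE := «V(·) is O-flat»`: `hRuledSt` by `flat_strictTransform_subschemeι_comp_stage` (…NatStrictTransformFlat p533590), `hSNC` by res-L1-w45b-lead-2's
(A′-1) v2 `hasSNCWith_member_centre_of_trace_transversal` (p608670; `𝓕 ≠ ⊥` from `¬ T ⊆ F`), `hTrace` by (A′-3)′
`comap_strictTransformIdeal_eq_vanishingIdeal_of_transversal'` (…NatTransversalStrictTransformTraceSlim).
-/

set_option linter.dupNamespace false -- mandated namespace `Summit.<Summit>.<Problem>` of this single-conjunct summit
set_option linter.overlappingInstances false -- signatures carry `[IsDomain O] [IsDiscreteValuationRing O]`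

noncomputable section

open CategoryTheory CategoryTheory.Limits AlgebraicGeometry TopologicalSpace Topology IsLocalRing
open Literature.AlgebraicGeometry.Resolution
open AlgebraicGeometry.Scheme.IdealSheafData
open Summit.ResolutionOfSingularities.ResolutionOfSingularities.Theses.EquisingularLift.Split
open Summit.ResolutionOfSingularities.ResolutionOfSingularities.Cruxes.EquisingularLift.StrataSplit

namespace Summit.ResolutionOfSingularities.ResolutionOfSingularities.Cruxes.EquisingularLiftNat.Sections

section Fact

variable (O : Type) [CommRing O] [IsDomain O] [IsDiscreteValuationRing O] (k : Type) [Field k]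
    (θ : O →+* k) (hθ : Function.Surjective θ)
    (P : Scheme.{0}) [IsIntegral P] (q : P ⟶ Spec (.of O)) [IsProper q] [SmoothOfRelativeDimension 3 q] (Y : Set P)
    (hYsp : Y ⊆ q ⁻¹' {IsLocalRing.closedPoint O}) (hYirr : IsIrreducible Y) (hYcl : IsClosed Y)
    (hPnoeth : IsLocallyNoetherian P) (hPreg : Scheme.IsRegular P)
    (Ch : ∀ X' : Scheme.{0}, (X' ⟶ P) → Set X' → Prop)
    (hChStep : ∀ (X' X'' : Scheme.{0}) (σ' : X' ⟶ P) (S' : Set X') (C : X'.IdealSheafData) (τ : X'' ⟶ X'),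
      Ch X' σ' S' → IsBlowup τ C → Scheme.IsRegular C.subscheme → Flat (C.subschemeι ≫ σ' ≫ q) →
      σ' '' (C.support : Set X') ⊆ {y | ¬ IsGenericPoint y Y} → (C.support : Set X') ∩ (σ' ≫ q) ⁻¹' {IsLocalRing.closedPoint O} ⊆ S' →
      Ch X'' (τ ≫ σ') (closure (τ ⁻¹' (S' \ (C.support : Set X')))))
    (hChSplit : ∀ (X' : Scheme.{0}) (σ' : X' ⟶ P) (S' : Set X'), Ch X' σ' S' → Chain P Y X' σ' S')

include hθ hYsp hYirr hYcl hPnoeth hPreg hChStep hChSplit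

set_option maxHeartbeats 800000 in
/-- **The Čech round of `TowerRoundBPrime` (T23-A′: transversally crossed members RETAINED) on `Tower.InvB` at the datum «`V(𝓔)` is `O`-flat», BOTH
HOST MENUS, every stand-in discharged** — from (T-k) as before, PLUS the three T23-A′ dischargers at `FE`: `hRuledSt` := `flat_strictTransform_subschemeι_comp_stage`
(res-L1-w45b-stub-2 p533590), `hSNC` := (A′-1) v2 `hasSNCWith_member_centre_of_trace_transversal` (res-L1-w45b-lead-2 p608670), `hTrace` := (A′-3)′
`comap_strictTransformIdeal_eq_vanishingIdeal_of_transversal'` (res-L1-w45b-stub-2), over res-L1-w45b-stub-4's widened core `Tower.invB_embRoundCore'` with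
`X3 F := ∃ hF, (T1) ∧ (T2)` = the third disjunct of `RoundTransportOKPrime` (res-L1-w45b-lead-2 p609826).
[OURS · L1 W4.5b · T23-A′ engine] toward `stub_elnat_defTowerBPrimePointResolutionThree`; NOT a statement of the manuscript. -/
theorem Tower.invB_embRound_of_fact_anyPrime (hFact : EmbeddedCurveLift O k θ P q) :
    ∀ {F₉ : Scheme.{0}} (Z₉ : Set F₉) (hZ₉ : IsClosed Z₉) {F₁₀ : Scheme.{0}} (υ' : F₁₀ ⟶ F₉)
    (G G' : Scheme.{0}) (γ : G ⟶ F₁₀) (T E : Set G) (Es : List (Set G)) (K H KH : Set G) (hH : IsClosed H) (Z : Set G) (hZ : IsClosed Z)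
    (υ₂ : G' ⟶ G) (K' E' : Set G') (Es' : List (Set G')),
    (Tower.InvB O k θ P q Y Ch (fun _ _ _ _ _ _ _ _ _ σ _ 𝓔 => Flat (𝓔.subschemeι ≫ σ ≫ q)) F₉ Z₉ hZ₉ F₁₀ υ' G γ T E Es K ∧
      IsClosed K ∧ K ⊆ closure (K \ E) ∧ K ≠ Set.univ) →
    ((H = E ∧ KH = K) ∨ (H ∈ Es ∧ KH = ∅)) →
    Z ⊆ H ∩ T → Z.Nonempty → TowerFull F₉ F₁₀ υ' Z₉ hZ₉ G γ Z hZ →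
    (∀ x : redSub G Z hZ, IsRegularLocalRing ((redSub G Z hZ).presheaf.stalk x)) →
    (∀ (i : redSub G Z hZ ⟶ redSub G H hH), i ≫ redSubι G H hH = redSubι G Z hZ →
      ∀ x : redSub G Z hZ, IsRegularLocalRing ((redSub G H hH).presheaf.stalk (i x))) →
    DirStepUnobs G H hH Z hZ →
    (∀ z : ↥(redSub G Z hZ), IsClosed ({z} : Set ↥(redSub G Z hZ)) → ringKrullDim ((redSub G Z hZ).presheaf.stalk z) = ((1 : ℕ) : WithBot ℕ∞)) →
    IsBlowup υ₂ (vanishingIdeal (⟨Z, hZ⟩ : Closeds G)) →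
    (K' = ∅ ∨ (closure (Z \ closure KH) = Z ∧ K' = closure (υ₂ ⁻¹' (KH \ Z)))) →
    (E' = υ₂ ⁻¹' Z ∨ E' = closure (υ₂ ⁻¹' (H \ Z))) →
    (∀ F' ∈ Es', ∃ F ∈ E :: Es, RoundTransportOKPrime υ₂ Z hZ H F F') →
    (Tower.InvB O k θ P q Y Ch (fun _ _ _ _ _ _ _ _ _ σ _ 𝓔 => Flat (𝓔.subschemeι ≫ σ ≫ q)) F₉ Z₉ hZ₉ F₁₀ υ' G' (υ₂ ≫ γ) (closure (υ₂ ⁻¹' (T \ Z))) E' Es' K' ∧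
      IsClosed K' ∧ K' ⊆ closure (K' \ E') ∧ K' ≠ Set.univ) := by
  intro F₉ Z₉ hZ₉ F₁₀ υ' G G' γ T E Es K H KH hH Z hZ υ₂ K' E' Es' hI hhost hZHT hZne hfull hZreg hHZreg hunobs hZdim hυ₂ hK' hE' hEs'
  obtain ⟨hinv, hKcl, hKE, hKne⟩ := hI
  obtain ⟨hυ', hZinf, hGint, hTcl, hTirr, hEcl, hTE, hEsB, X, σ, S, jG, tG, hCh, hXint, hXnoeth, hXreg, hdom, hsq, hTS, hExc, hExcF⟩ := hinv
  haveI := hGint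
  haveI := hXint
  haveI := hXnoeth
  have hZH : Z ⊆ H := fun z hz => (hZHT hz).1
  have hZsupp : ((vanishingIdeal (⟨Z, hZ⟩ : Closeds G) : G.IdealSheafData).support : Set G) = Z :=
    Scheme.IdealSheafData.coe_support_vanishingIdeal _
  -- the candidates `E :: Es`, shadows forgotten
  have hCand : ∀ F ∈ E :: Es, ∃ hF : IsClosed F, ¬ T ⊆ F ∧
      Tower.Exc₃ O P q Y (fun _ _ _ _ _ _ _ _ _ σ _ 𝓔 => Flat (𝓔.subschemeι ≫ σ ≫ q)) Z₉ hZ₉ υ' G γ F hF ∅ X σ jG := by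
    intro F hF
    rcases List.mem_cons.mp hF with rfl | hF
    · exact ⟨hEcl, hTE, Tower.exc₃_forgetShadow O P q Y _ (hExc hEcl)⟩
    · exact ⟨(hEsB F hF).1, (hEsB F hF).2, hExcF F hF (hEsB F hF).1⟩
  -- the host's datum and bookkeeping
  have hhost' : ¬ T ⊆ H ∧ Tower.Exc₃ O P q Y (fun _ _ _ _ _ _ _ _ _ σ _ 𝓔 => Flat (𝓔.subschemeι ≫ σ ≫ q)) Z₉ hZ₉ υ' G γ H hH KH X σ jG ∧
      IsClosed KH ∧ KH ⊆ closure (KH \ H) ∧ KH ≠ Set.univ := by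
    rcases hhost with ⟨rfl, rfl⟩ | ⟨hmem, rfl⟩
    · exact ⟨hTE, hExc hH, hKcl, hKE, hKne⟩
    · refine ⟨(hEsB H hmem).2, hExcF H hmem hH, isClosed_empty, Set.empty_subset _, ?_⟩
      obtain ⟨z, _⟩ := hZne
      haveI : Nonempty G := ⟨z⟩
      exact Set.empty_ne_univ
  obtain ⟨hTH, hExcH, hKHcl, hKHE, hKHne⟩ := hhost'
  have hHne : H ≠ Set.univ := fun h => hTH (h ▸ Set.subset_univ _)
  have hTZ : ¬ T ⊆ Z := fun h => hTH (h.trans hZH)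
  -- the dischargers at `FE`
  have hC := Tower.hCentre_of_fact_any O k θ hθ P q Y hYsp hYirr hYcl hPnoeth hPreg Ch hChStep hChSplit hFact Z₉ hZ₉ υ' G γ T H hH Z hZ hHne
    hZH hZreg hHZreg hunobs hZdim
  have hS := Tower.hShadow_of_any O k θ hθ P q ‹IsProper q› Y hYirr hYcl hPnoeth hPreg Ch hChSplit ‹IsIntegral P› Z₉ hZ₉ υ' G G' γ T H KH hH Z hZ
    υ₂ hυ₂
  have hSo := Tower.hShadowOld_of_any O k θ hθ P q ‹IsProper q› Y hYirr hYcl hPnoeth hPreg Ch hChSplit ‹IsIntegral P› Z₉ hZ₉ υ' G G' γ T H KH hH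
    Z hZ υ₂ hυ₂
  have hBorn : ∀ (X : Scheme.{0}) (σ : X ⟶ P) (S : Set X) (jG : G ⟶ X) (tG : G ⟶ Spec (.of k)) (𝓔 𝒦₁ : X.IdealSheafData)
      (X'' : Scheme.{0}) (τ : X'' ⟶ X) (j₂ : G' ⟶ X'') (t₂ : G' ⟶ Spec (.of k)),
      Ch X σ S → IsIntegral X → IsLocallyNoetherian X → Scheme.IsRegular X → IsDominant (σ ≫ q) →
      IsPullback jG tG (σ ≫ q) (Spec.map (CommRingCat.ofHom θ)) → jG '' T = S →
      (𝓔 ⊔ 𝒦₁).comap jG = vanishingIdeal ⟨Z, hZ⟩ → Flat ((𝓔 ⊔ 𝒦₁).subschemeι ≫ σ ≫ q) → Scheme.IsRegular (𝓔 ⊔ 𝒦₁).subscheme →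
      Scheme.IsRegular 𝓔.subscheme → IsBlowup τ (𝓔 ⊔ 𝒦₁) → IsPullback j₂ t₂ ((τ ≫ σ) ≫ q) (Spec.map (CommRingCat.ofHom θ)) →
      j₂ ≫ τ = υ₂ ≫ jG →
      Flat ((((𝓔 ⊔ 𝒦₁).comap τ)).subschemeι ≫ (τ ≫ σ) ≫ q) := by
    intro X σ S jG tG 𝓔 𝒦₁ X'' τ j₂ t₂ _ _ hXnoeth hXreg _ _ _ _ hc2 hc3 _ hτ _ _
    haveI := hXnoeth
    rw [Category.assoc]
    exact flat_exceptional_of_isBlowup_regularCentre O X X'' (σ ≫ q) (𝓔 ⊔ 𝒦₁) hXreg hc3 hc2 τ hτ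
  have hIso : ∀ (G₀ G₀' : Scheme.{0}) (γ₀ : G₀ ⟶ F₁₀) (γ₀' : G₀' ⟶ F₁₀) (E₀ : Set G₀) (E₀' : Set G₀') (X₀ X₀'' : Scheme.{0})
      (σ₀ : X₀ ⟶ P) (j₀ : G₀ ⟶ X₀) (j₀' : G₀' ⟶ X₀'') (𝓔₀ : X₀.IdealSheafData) (𝓔₀' : X₀''.IdealSheafData) (τ₀ : X₀'' ⟶ X₀),
      (∃ e : 𝓔₀'.subscheme ≅ 𝓔₀.subscheme, e.hom ≫ 𝓔₀.subschemeι = 𝓔₀'.subschemeι ≫ τ₀) →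
      (fun _ _ _ _ _ _ _ _ _ σ _ 𝓔 => Flat (𝓔.subschemeι ≫ σ ≫ q)) F₉ Z₉ hZ₉ F₁₀ υ' G₀ γ₀ E₀ X₀ σ₀ j₀ 𝓔₀ →
      (fun _ _ _ _ _ _ _ _ _ σ _ 𝓔 => Flat (𝓔.subschemeι ≫ σ ≫ q)) F₉ Z₉ hZ₉ F₁₀ υ' G₀' γ₀' E₀' X₀'' (τ₀ ≫ σ₀) j₀' 𝓔₀' := by
    intro G₀ G₀' γ₀ γ₀' E₀ E₀' X₀ X₀'' σ₀ j₀ j₀' 𝓔₀ 𝓔₀' τ₀ he hflat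
    obtain ⟨e, he⟩ := he
    have hflat' : Flat (𝓔₀.subschemeι ≫ σ₀ ≫ q) := hflat
    have heq : 𝓔₀'.subschemeι ≫ (τ₀ ≫ σ₀) ≫ q = e.hom ≫ 𝓔₀.subschemeι ≫ σ₀ ≫ q := by
      rw [← Category.assoc e.hom, he]; simp only [Category.assoc]
    show Flat (𝓔₀'.subschemeι ≫ (τ₀ ≫ σ₀) ≫ q)
    rw [heq]
    infer_instance
  -- T23-A′: the strict-transform transport of the datum `FE` (res-L1-w45b-stub-2's T-STFLAT-GEN)
  have hRuledSt : ∀ (G₀ G₀' : Scheme.{0}) (γ₀ : G₀ ⟶ F₁₀) (γ₀' : G₀' ⟶ F₁₀) (E₀ : Set G₀) (E₀' : Set G₀') (X₀ X₀'' : Scheme.{0})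
      (σ₀ : X₀ ⟶ P) (j₀ : G₀ ⟶ X₀) (j₀' : G₀' ⟶ X₀'') (𝓔₀ C₀ : X₀.IdealSheafData) (τ₀ : X₀'' ⟶ X₀),
      IsBlowup τ₀ C₀ → IsLocallyNoetherian X₀ → IsLocallyNoetherian X₀'' →
      (fun _ _ _ _ _ _ _ _ _ σ _ 𝓔 => Flat (𝓔.subschemeι ≫ σ ≫ q)) F₉ Z₉ hZ₉ F₁₀ υ' G₀ γ₀ E₀ X₀ σ₀ j₀ 𝓔₀ →
      (fun _ _ _ _ _ _ _ _ _ σ _ 𝓔 => Flat (𝓔.subschemeι ≫ σ ≫ q)) F₉ Z₉ hZ₉ F₁₀ υ' G₀' γ₀' E₀' X₀'' (τ₀ ≫ σ₀) j₀'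
        (strictTransformIdeal τ₀ C₀ 𝓔₀) := by
    intro G₀ G₀' γ₀ γ₀' E₀ E₀' X₀ X₀'' σ₀ j₀ j₀' 𝓔₀ C₀ τ₀ hτ₀ hX₀ hX₀'' hflat
    haveI := hX₀
    haveI := hX₀''
    have hflat' : Flat (𝓔₀.subschemeι ≫ σ₀ ≫ q) := hflat
    show Flat ((strictTransformIdeal τ₀ C₀ 𝓔₀).subschemeι ≫ (τ₀ ≫ σ₀) ≫ q)
    exact flat_strictTransform_subschemeι_comp_stage O σ₀ q τ₀ C₀ hτ₀ 𝓔₀ hflat'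
  -- T23-A′: the third transport alternative = the stalkwise (T1) ∧ (T2) of `RoundTransportOKPrime`
  let X3 : Set G → Prop := fun F => ∃ hF : IsClosed F,
    (∀ g ∈ Z ∩ F, stalkIdeal (vanishingIdeal (⟨Z, hZ⟩ : Closeds G)) g ⊔ stalkIdeal (vanishingIdeal (⟨F, hF⟩ : Closeds G)) g =
        maximalIdeal (G.presheaf.stalk g)) ∧
      ∀ g ∈ Z ∩ F, stalkIdeal (vanishingIdeal (⟨Z, hZ⟩ : Closeds G)) g ≠ maximalIdeal (G.presheaf.stalk g)
  have hEs'' : ∀ F' ∈ Es', ∃ F ∈ E :: Es, (F = H ∨ Disjoint Z F ∨ X3 F) ∧ F' = closure (υ₂ ⁻¹' (F \ Z)) := by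
    intro F' hF'
    obtain ⟨F, hF, hok⟩ := hEs' F' hF'
    exact ⟨F, hF, hok⟩
  -- T23-A′ (A′-1): snc of a transversally crossed member with the centre (res-L1-w45b-lead-2 p608670)
  have hSNC : ∀ (C 𝓕 : X.IdealSheafData) (F : Set G) (hF : IsClosed F), X3 F → IsProper (σ ≫ q) →
      C.comap jG = vanishingIdeal ⟨Z, hZ⟩ → Flat (C.subschemeι ≫ σ ≫ q) → Scheme.IsRegular C.subscheme →
      𝓕.comap jG = vanishingIdeal ⟨F, hF⟩ → (∀ z : X, (stalkIdeal 𝓕 z).IsPrincipal) → Scheme.IsRegular 𝓕.subscheme →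
      σ '' (𝓕.support : Set X) ⊆ {p : P | ¬ IsGenericPoint p Y} →
      (fun _ _ _ _ _ _ _ _ _ σ _ 𝓔 => Flat (𝓔.subschemeι ≫ σ ≫ q)) F₉ Z₉ hZ₉ F₁₀ υ' G γ F X σ jG 𝓕 → ¬ T ⊆ F →
      HasSNCWith [𝓕] C := by
    intro C 𝓕 F hF hX3 hprop hC _ hCreg hF1 hF2 hF3 _ _ hTF
    obtain ⟨hF', hT1, hT2⟩ := hX3
    haveI := hprop
    have h𝓕0 : 𝓕 ≠ ⊥ := by
      rintro rfl
      apply hTF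
      have h1 : (vanishingIdeal (⟨F, hF⟩ : Closeds G) : G.IdealSheafData) = ⊥ := by
        rw [← hF1, Scheme.IdealSheafData.comap_bot]
      have h2 : ((vanishingIdeal (⟨F, hF⟩ : Closeds G) : G.IdealSheafData).support : Set G) = Set.univ := by
        rw [h1, Scheme.IdealSheafData.support_bot]; rfl
      rw [Scheme.IdealSheafData.coe_support_vanishingIdeal] at h2
      change F = Set.univ at h2
      rw [h2]; exact Set.subset_univ _
    exact hasSNCWith_member_centre_of_trace_transversal hXreg hsq hθ hC hCreg hF1 hF2 hF3 h𝓕0 hT1 hT2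
  -- T23-A′ (A′-3): the special-fibre trace of the strict transform (res-L1-w45b-stub-2, slim twin)
  have hTrace : ∀ (C 𝓕 : X.IdealSheafData) (F : Set G) (hF : IsClosed F) (X₂ : Scheme.{0}) (τ : X₂ ⟶ X) (j₂ : G' ⟶ X₂)
      (t₂ : G' ⟶ Spec (.of k)), X3 F → IsProper (σ ≫ q) →
      C.comap jG = vanishingIdeal ⟨Z, hZ⟩ → Flat (C.subschemeι ≫ σ ≫ q) → Scheme.IsRegular C.subscheme →
      IsBlowup τ C → IsLocallyNoetherian X₂ → IsPullback j₂ t₂ ((τ ≫ σ) ≫ q) (Spec.map (CommRingCat.ofHom θ)) → j₂ ≫ τ = υ₂ ≫ jG →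
      𝓕.comap jG = vanishingIdeal ⟨F, hF⟩ → (∀ z : X, (stalkIdeal 𝓕 z).IsPrincipal) → Scheme.IsRegular 𝓕.subscheme →
      σ '' (𝓕.support : Set X) ⊆ {p : P | ¬ IsGenericPoint p Y} →
      (fun _ _ _ _ _ _ _ _ _ σ _ 𝓔 => Flat (𝓔.subschemeι ≫ σ ≫ q)) F₉ Z₉ hZ₉ F₁₀ υ' G γ F X σ jG 𝓕 → ¬ T ⊆ F →
      HasSNCWith [𝓕] C →
      (strictTransformIdeal τ C 𝓕).comap j₂ = vanishingIdeal (⟨closure (υ₂ ⁻¹' (F \ Z)), isClosed_closure⟩ : Closeds G') := by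
    intro C 𝓕 F hF X₂ τ j₂ t₂ hX3 _ hC hCflat _ hτ hX₂ hsq₂ hcomm hF1 _ _ _ _ _ hE
    obtain ⟨hF', hT1, hT2⟩ := hX3
    haveI := hX₂
    exact comap_strictTransformIdeal_eq_vanishingIdeal_of_transversal' hsq hθ hτ hυ₂ hcomm hsq₂ hC hCflat hT1 hT2 hF1 hE
  -- the core
  have hB := Tower.invB_embRoundCore' O k θ hθ P q Y hYirr hYcl hPnoeth hPreg Ch hChSplit hChStep _ Z₉ hZ₉ υ' hIso hRuledSt G G' γ T H KH
    (E :: Es) hH Z hZ υ₂ hυ' hZinf hTirr hTH X σ S jG tG hCh hXreg hdom hsq hTS hExcH hCand hZHT hfull hυ₂ hKHcl hKHE hKHne hC hS hSo hBorn X3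
    hSNC hTrace K' E' Es' hK' hE' hEs''
  have hG'int : IsIntegral G' := hB.2.2.1
  haveI := hG'int
  -- the side facts of `K'`
  rcases hK' with rfl | ⟨-, rfl⟩
  · exact ⟨hB, isClosed_empty, Set.empty_subset _, Set.empty_ne_univ⟩
  · have hne : closure (υ₂ ⁻¹' (KH \ Z)) ≠ Set.univ :=
      closure_preimage_ne_univ υ₂ _ hυ₂ KH Z hKHcl hKHne hZ (fun h => hTZ (h ▸ Set.subset_univ _)) hZsupp.le _
        (Set.preimage_mono fun z hz => hz.1)
    refine ⟨hB, isClosed_closure, ?_, hne⟩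
    rcases hE' with rfl | rfl
    · exact closure_preimage_diff_subset_closure_diff_preimage υ₂ KH Z
    · have h := closure_preimage_diff_subset_of_isBlowup υ₂ (vanishingIdeal (⟨Z, hZ⟩ : Closeds G)) hυ₂ KH H hH hKHE
      rw [hZsupp] at h
      exact h


omit [IsIntegral P] [SmoothOfRelativeDimension 3 q] hYsp in
set_option maxHeartbeats 800000 in
/-- **The cone-witnessed round of `TowerRoundBPrime` (T23-A′) on `Tower.InvB` at the datum «`V(𝓔)` is `O`-flat»** (host = the running surface),
stand-ins discharged incl. the three T23-A′ obligations of res-L1-w45b-stub-4's widened core `Tower.invB_coneRoundCore'` (as in the Čech twin above).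
[OURS · L1 W4.5b · T23-A′ engine] toward `stub_elnat_defTowerBPrimePointResolutionThree`; NOT a statement of the manuscript. -/
theorem Tower.invB_coneRound_of_anyPrime :
    ∀ {F₉ : Scheme.{0}} (Z₉ : Set F₉) (hZ₉ : IsClosed Z₉) {F₁₀ : Scheme.{0}} (υ' : F₁₀ ⟶ F₉)
    (G G' : Scheme.{0}) (γ : G ⟶ F₁₀) (T E : Set G) (Es : List (Set G)) (K : Set G) (hE : IsClosed E) (Z : Set G) (hZ : IsClosed Z)
    (υ₂ : G' ⟶ G) (K' E' : Set G') (Es' : List (Set G')),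
    (Tower.InvB O k θ P q Y Ch (fun _ _ _ _ _ _ _ _ _ σ _ 𝓔 => Flat (𝓔.subschemeι ≫ σ ≫ q)) F₉ Z₉ hZ₉ F₁₀ υ' G γ T E Es K ∧
      IsClosed K ∧ K ⊆ closure (K \ E) ∧ K ≠ Set.univ) →
    Z ⊆ E ∩ T → Z.Nonempty → TowerFull F₉ F₁₀ υ' Z₉ hZ₉ G γ Z hZ → ConeWitness G E hE K Z hZ →
    IsBlowup υ₂ (vanishingIdeal (⟨Z, hZ⟩ : Closeds G)) →
    (K' = ∅ ∨ K' = closure (υ₂ ⁻¹' (K \ Z))) →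
    (E' = υ₂ ⁻¹' Z ∨ E' = closure (υ₂ ⁻¹' (E \ Z))) →
    (∀ F' ∈ Es', ∃ F ∈ E :: Es, RoundTransportOKPrime υ₂ Z hZ E F F') →
    (Tower.InvB O k θ P q Y Ch (fun _ _ _ _ _ _ _ _ _ σ _ 𝓔 => Flat (𝓔.subschemeι ≫ σ ≫ q)) F₉ Z₉ hZ₉ F₁₀ υ' G' (υ₂ ≫ γ) (closure (υ₂ ⁻¹' (T \ Z))) E' Es' K' ∧
      IsClosed K' ∧ K' ⊆ closure (K' \ E') ∧ K' ≠ Set.univ) := by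
  intro F₉ Z₉ hZ₉ F₁₀ υ' G G' γ T E Es K hE Z hZ υ₂ K' E' Es' hI hZET hZne hfull hcone hυ₂ hK' hE' hEs'
  obtain ⟨hinv, hKcl, hKE, hKne⟩ := hI
  have hZE : Z ⊆ E := fun z hz => (hZET hz).1
  have hEZ : E ⊆ closure (E \ Z) :=
    Tower.subset_closure_diff_of_inv₃_coneWitness O k θ hθ P q Y Ch _ Z₉ hZ₉ υ' G γ T E K hE Z hZ
      (Tower.invB_inv₃ O k θ P q Y Ch _ F₉ Z₉ hZ₉ F₁₀ υ' G γ T E Es K hinv) hfull hZE hcone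
  obtain ⟨hυ', hZinf, hGint, hTcl, hTirr, hEcl, hTE, hEsB, X, σ, S, jG, tG, hCh, hXint, hXnoeth, hXreg, hdom, hsq, hTS, hExc, hExcF⟩ := hinv
  haveI := hGint
  haveI := hXint
  haveI := hXnoeth
  have hTZ : ¬ T ⊆ Z := fun h => hTE (h.trans hZE)
  have hZsupp : ((vanishingIdeal (⟨Z, hZ⟩ : Closeds G) : G.IdealSheafData).support : Set G) = Z :=
    Scheme.IdealSheafData.coe_support_vanishingIdeal _
  have hCand : ∀ F ∈ E :: Es, ∃ hF : IsClosed F, ¬ T ⊆ F ∧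
      Tower.Exc₃ O P q Y (fun _ _ _ _ _ _ _ _ _ σ _ 𝓔 => Flat (𝓔.subschemeι ≫ σ ≫ q)) Z₉ hZ₉ υ' G γ F hF ∅ X σ jG := by
    intro F hF
    rcases List.mem_cons.mp hF with rfl | hF
    · exact ⟨hEcl, hTE, Tower.exc₃_forgetShadow O P q Y _ (hExc hEcl)⟩
    · exact ⟨(hEsB F hF).1, (hEsB F hF).2, hExcF F hF (hEsB F hF).1⟩
  have hBorn : ∀ (X : Scheme.{0}) (σ : X ⟶ P) (S : Set X) (jG : G ⟶ X) (tG : G ⟶ Spec (.of k)) (𝓔 𝒦 : X.IdealSheafData)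
      (X'' : Scheme.{0}) (τ : X'' ⟶ X) (j₂ : G' ⟶ X'') (t₂ : G' ⟶ Spec (.of k)),
      Ch X σ S → IsIntegral X → IsLocallyNoetherian X → Scheme.IsRegular X → IsDominant (σ ≫ q) →
      IsPullback jG tG (σ ≫ q) (Spec.map (CommRingCat.ofHom θ)) → jG '' T = S →
      (𝓔 ⊔ 𝒦).comap jG = vanishingIdeal ⟨Z, hZ⟩ → Flat ((𝓔 ⊔ 𝒦).subschemeι ≫ σ ≫ q) → Scheme.IsRegular (𝓔 ⊔ 𝒦).subscheme →
      Scheme.IsRegular 𝓔.subscheme → IsBlowup τ (𝓔 ⊔ 𝒦) → IsPullback j₂ t₂ ((τ ≫ σ) ≫ q) (Spec.map (CommRingCat.ofHom θ)) →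
      j₂ ≫ τ = υ₂ ≫ jG →
      Flat ((((𝓔 ⊔ 𝒦).comap τ)).subschemeι ≫ (τ ≫ σ) ≫ q) := by
    intro X σ S jG tG 𝓔 𝒦 X'' τ j₂ t₂ _ _ hXnoeth hXreg _ _ _ _ hc2 hc3 _ hτ _ _
    haveI := hXnoeth
    rw [Category.assoc]
    exact flat_exceptional_of_isBlowup_regularCentre O X X'' (σ ≫ q) (𝓔 ⊔ 𝒦) hXreg hc3 hc2 τ hτ
  have hIso : ∀ (G₀ G₀' : Scheme.{0}) (γ₀ : G₀ ⟶ F₁₀) (γ₀' : G₀' ⟶ F₁₀) (E₀ : Set G₀) (E₀' : Set G₀') (X₀ X₀'' : Scheme.{0})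
      (σ₀ : X₀ ⟶ P) (j₀ : G₀ ⟶ X₀) (j₀' : G₀' ⟶ X₀'') (𝓔₀ : X₀.IdealSheafData) (𝓔₀' : X₀''.IdealSheafData) (τ₀ : X₀'' ⟶ X₀),
      (∃ e : 𝓔₀'.subscheme ≅ 𝓔₀.subscheme, e.hom ≫ 𝓔₀.subschemeι = 𝓔₀'.subschemeι ≫ τ₀) →
      (fun _ _ _ _ _ _ _ _ _ σ _ 𝓔 => Flat (𝓔.subschemeι ≫ σ ≫ q)) F₉ Z₉ hZ₉ F₁₀ υ' G₀ γ₀ E₀ X₀ σ₀ j₀ 𝓔₀ →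
      (fun _ _ _ _ _ _ _ _ _ σ _ 𝓔 => Flat (𝓔.subschemeι ≫ σ ≫ q)) F₉ Z₉ hZ₉ F₁₀ υ' G₀' γ₀' E₀' X₀'' (τ₀ ≫ σ₀) j₀' 𝓔₀' := by
    intro G₀ G₀' γ₀ γ₀' E₀ E₀' X₀ X₀'' σ₀ j₀ j₀' 𝓔₀ 𝓔₀' τ₀ he hflat
    obtain ⟨e, he⟩ := he
    have hflat' : Flat (𝓔₀.subschemeι ≫ σ₀ ≫ q) := hflat
    have heq : 𝓔₀'.subschemeι ≫ (τ₀ ≫ σ₀) ≫ q = e.hom ≫ 𝓔₀.subschemeι ≫ σ₀ ≫ q := by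
      rw [← Category.assoc e.hom, he]; simp only [Category.assoc]
    show Flat (𝓔₀'.subschemeι ≫ (τ₀ ≫ σ₀) ≫ q)
    rw [heq]
    infer_instance
  -- T23-A′: the strict-transform transport of the datum `FE` (res-L1-w45b-stub-2's T-STFLAT-GEN)
  have hRuledSt : ∀ (G₀ G₀' : Scheme.{0}) (γ₀ : G₀ ⟶ F₁₀) (γ₀' : G₀' ⟶ F₁₀) (E₀ : Set G₀) (E₀' : Set G₀') (X₀ X₀'' : Scheme.{0})
      (σ₀ : X₀ ⟶ P) (j₀ : G₀ ⟶ X₀) (j₀' : G₀' ⟶ X₀'') (𝓔₀ C₀ : X₀.IdealSheafData) (τ₀ : X₀'' ⟶ X₀),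
      IsBlowup τ₀ C₀ → IsLocallyNoetherian X₀ → IsLocallyNoetherian X₀'' →
      (fun _ _ _ _ _ _ _ _ _ σ _ 𝓔 => Flat (𝓔.subschemeι ≫ σ ≫ q)) F₉ Z₉ hZ₉ F₁₀ υ' G₀ γ₀ E₀ X₀ σ₀ j₀ 𝓔₀ →
      (fun _ _ _ _ _ _ _ _ _ σ _ 𝓔 => Flat (𝓔.subschemeι ≫ σ ≫ q)) F₉ Z₉ hZ₉ F₁₀ υ' G₀' γ₀' E₀' X₀'' (τ₀ ≫ σ₀) j₀'
        (strictTransformIdeal τ₀ C₀ 𝓔₀) := by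
    intro G₀ G₀' γ₀ γ₀' E₀ E₀' X₀ X₀'' σ₀ j₀ j₀' 𝓔₀ C₀ τ₀ hτ₀ hX₀ hX₀'' hflat
    haveI := hX₀
    haveI := hX₀''
    have hflat' : Flat (𝓔₀.subschemeι ≫ σ₀ ≫ q) := hflat
    show Flat ((strictTransformIdeal τ₀ C₀ 𝓔₀).subschemeι ≫ (τ₀ ≫ σ₀) ≫ q)
    exact flat_strictTransform_subschemeι_comp_stage O σ₀ q τ₀ C₀ hτ₀ 𝓔₀ hflat'
  -- T23-A′: the third transport alternative = the stalkwise (T1) ∧ (T2) of `RoundTransportOKPrime`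
  let X3 : Set G → Prop := fun F => ∃ hF : IsClosed F,
    (∀ g ∈ Z ∩ F, stalkIdeal (vanishingIdeal (⟨Z, hZ⟩ : Closeds G)) g ⊔ stalkIdeal (vanishingIdeal (⟨F, hF⟩ : Closeds G)) g =
        maximalIdeal (G.presheaf.stalk g)) ∧
      ∀ g ∈ Z ∩ F, stalkIdeal (vanishingIdeal (⟨Z, hZ⟩ : Closeds G)) g ≠ maximalIdeal (G.presheaf.stalk g)
  have hEs'' : ∀ F' ∈ Es', ∃ F ∈ E :: Es, (F = E ∨ Disjoint Z F ∨ X3 F) ∧ F' = closure (υ₂ ⁻¹' (F \ Z)) := by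
    intro F' hF'
    obtain ⟨F, hF, hok⟩ := hEs' F' hF'
    exact ⟨F, hF, hok⟩
  -- T23-A′ (A′-1): snc of a transversally crossed member with the centre (res-L1-w45b-lead-2 p608670)
  have hSNC : ∀ (C 𝓕 : X.IdealSheafData) (F : Set G) (hF : IsClosed F), X3 F → IsProper (σ ≫ q) →
      C.comap jG = vanishingIdeal ⟨Z, hZ⟩ → Flat (C.subschemeι ≫ σ ≫ q) → Scheme.IsRegular C.subscheme →
      𝓕.comap jG = vanishingIdeal ⟨F, hF⟩ → (∀ z : X, (stalkIdeal 𝓕 z).IsPrincipal) → Scheme.IsRegular 𝓕.subscheme →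
      σ '' (𝓕.support : Set X) ⊆ {p : P | ¬ IsGenericPoint p Y} →
      (fun _ _ _ _ _ _ _ _ _ σ _ 𝓔 => Flat (𝓔.subschemeι ≫ σ ≫ q)) F₉ Z₉ hZ₉ F₁₀ υ' G γ F X σ jG 𝓕 → ¬ T ⊆ F →
      HasSNCWith [𝓕] C := by
    intro C 𝓕 F hF hX3 hprop hC _ hCreg hF1 hF2 hF3 _ _ hTF
    obtain ⟨hF', hT1, hT2⟩ := hX3
    haveI := hprop
    have h𝓕0 : 𝓕 ≠ ⊥ := by
      rintro rfl
      apply hTF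
      have h1 : (vanishingIdeal (⟨F, hF⟩ : Closeds G) : G.IdealSheafData) = ⊥ := by
        rw [← hF1, Scheme.IdealSheafData.comap_bot]
      have h2 : ((vanishingIdeal (⟨F, hF⟩ : Closeds G) : G.IdealSheafData).support : Set G) = Set.univ := by
        rw [h1, Scheme.IdealSheafData.support_bot]; rfl
      rw [Scheme.IdealSheafData.coe_support_vanishingIdeal] at h2
      change F = Set.univ at h2
      rw [h2]; exact Set.subset_univ _
    exact hasSNCWith_member_centre_of_trace_transversal hXreg hsq hθ hC hCreg hF1 hF2 hF3 h𝓕0 hT1 hT2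
  -- T23-A′ (A′-3): the special-fibre trace of the strict transform (res-L1-w45b-stub-2, slim twin)
  have hTrace : ∀ (C 𝓕 : X.IdealSheafData) (F : Set G) (hF : IsClosed F) (X₂ : Scheme.{0}) (τ : X₂ ⟶ X) (j₂ : G' ⟶ X₂)
      (t₂ : G' ⟶ Spec (.of k)), X3 F → IsProper (σ ≫ q) →
      C.comap jG = vanishingIdeal ⟨Z, hZ⟩ → Flat (C.subschemeι ≫ σ ≫ q) → Scheme.IsRegular C.subscheme →
      IsBlowup τ C → IsLocallyNoetherian X₂ → IsPullback j₂ t₂ ((τ ≫ σ) ≫ q) (Spec.map (CommRingCat.ofHom θ)) → j₂ ≫ τ = υ₂ ≫ jG →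
      𝓕.comap jG = vanishingIdeal ⟨F, hF⟩ → (∀ z : X, (stalkIdeal 𝓕 z).IsPrincipal) → Scheme.IsRegular 𝓕.subscheme →
      σ '' (𝓕.support : Set X) ⊆ {p : P | ¬ IsGenericPoint p Y} →
      (fun _ _ _ _ _ _ _ _ _ σ _ 𝓔 => Flat (𝓔.subschemeι ≫ σ ≫ q)) F₉ Z₉ hZ₉ F₁₀ υ' G γ F X σ jG 𝓕 → ¬ T ⊆ F →
      HasSNCWith [𝓕] C →
      (strictTransformIdeal τ C 𝓕).comap j₂ = vanishingIdeal (⟨closure (υ₂ ⁻¹' (F \ Z)), isClosed_closure⟩ : Closeds G') := by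
    intro C 𝓕 F hF X₂ τ j₂ t₂ hX3 _ hC hCflat _ hτ hX₂ hsq₂ hcomm hF1 _ _ _ _ _ hE
    obtain ⟨hF', hT1, hT2⟩ := hX3
    haveI := hX₂
    exact comap_strictTransformIdeal_eq_vanishingIdeal_of_transversal' hsq hθ hτ hυ₂ hcomm hsq₂ hC hCflat hT1 hT2 hF1 hE
  -- the core
  have hB := Tower.invB_coneRoundCore' O k θ hθ P q Y hYirr hYcl hPnoeth hPreg Ch hChSplit hChStep _ Z₉ hZ₉ υ' hIso hRuledSt G G' γ T E K
    (E :: Es) hE Z hZ υ₂ hυ' hZinf hTirr hTE X σ S jG tG hCh hXreg hdom hsq hTS (hExc hE) hCand hZET hZne hfull hcone hυ₂ hKcl hKE hKne hEZ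
    hBorn K' E' Es' hK' hE' X3 hSNC hTrace hEs''
  have hG'int : IsIntegral G' := hB.2.2.1
  haveI := hG'int
  rcases hK' with rfl | rfl
  · exact ⟨hB, isClosed_empty, Set.empty_subset _, Set.empty_ne_univ⟩
  · have hne : closure (υ₂ ⁻¹' (K \ Z)) ≠ Set.univ :=
      closure_preimage_ne_univ υ₂ _ hυ₂ K Z hKcl hKne hZ (fun h => hTZ (h ▸ Set.subset_univ _)) hZsupp.le _
        (Set.preimage_mono fun z hz => hz.1)
    refine ⟨hB, isClosed_closure, ?_, hne⟩
    rcases hE' with rfl | rfl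
    · exact closure_preimage_diff_subset_closure_diff_preimage υ₂ K Z
    · have h := closure_preimage_diff_subset_of_isBlowup υ₂ (vanishingIdeal (⟨Z, hZ⟩ : Closeds G)) hυ₂ K E hE hKE
      rw [hZsupp] at h
      exact h

end Fact

end Summit.ResolutionOfSingularities.ResolutionOfSingularities.Cruxes.EquisingularLiftNat.Sections

end
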